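/-
Copyright (c) 2026. All rights reserved.
Released under Apache 2.0 license as described in the file LICENSE.
-/
import Literature.NumberTheory.Automorphic.EichlerOrderAtkinLehnerIdealsExactDivisors
import HarnessLib

/-!
# The codifferent and the discriminant of an Eichler order: `O♯ = N⁻¹ 𝔔_N(O)`, `[O : 𝔔_m] = m²` (`m ∥ N`),
# `disc O = [O♯ : O] = N²`, `N = N⁺N⁻` (Vignéras I §4 Lemme 4.7, II §1 Cor. 1.7, II §2, III §5; Voight 15.6.17, 16.4.10, 16.8, 23.4.12, 23.4.19, 24.2)

[tag: quaternion_algebra] [tag: eichler_order]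

Topic `NumberTheory/Automorphic`; THEOREMS ONLY (no definition, no named fact, no instance, no notation; net debt `0`).
Lane `lit-hodgefound`, seat p12, gen 54 — sequel of `EichlerOrderAtkinLehnerIdealsExactDivisors.lean` (`𝔔_m = O P_{primes m}`
for `m ∥ N⁺N⁻`) and of `QuaternionDiscriminantIndex.lean` (the dual `O₁♯` of a MAXIMAL order: `[O₁♯ : O₁] = (N⁻)²`, from the
local duals at split primes — `M₂(ℤ_p)` is self-dual, `forall_not_dvd_den_reducedTrace_iff_of_split` — and at ramified
primes — `π⁻¹ O₍q₎`, `forall_not_dvd_den_reducedTrace_iff_of_ramified`). Here the missing local computation at a SPLIT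
LEVEL prime and the global identification of the trace dual of an Eichler order.

THE PRINTED STATEMENTS. Vignéras, *Arithmétique des algèbres de quaternions*, Ch. I §4 Lemme 4.7 (the dual lattice
`L♯ = {x : t(xL) ⊆ R}` and the different), Ch. II §2 (the Eichler order `O = (R R; 𝔭^n R)` of level `𝔭^n` in `M₂(K)`, its
normaliser and two-sided ideals), Ch. II §1 Cor. 1.7 (ramified: «la différente `O♯⁻¹` de `O` est `P`»). Voight, *Quaternion
Algebras*: Lemma 15.6.17 «`disc(O) = [codiff(O) : O]_R`», 16.8 («`diff(O) := codiff(O)⁻¹`», (16.8.4) «`nrd(diff(O)) =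
discrd(O)`»), 23.4.12 («`discrd(O) = [M₂(R) : O]_R = 𝔭^e`» for the standard Eichler order of level `𝔭^e`), 23.4.19
(«`𝔑 = 𝔇𝔐` … we call `𝔐` the level»), Def. 24.2.1 («`O` is Gorenstein if `codiff(O)` is invertible»; Eichler orders are,
24.2).

For a level model `O₍p₎ = Φ⁻¹(ℤ_p ℤ_p; p^e ℤ_p ℤ_p)` (`Φ : B →ₐ[ℚ] M₂(ℚ_p)`; `AtkinLehner.IsLevelShape e`) the trace dual of
the local order is `Φ⁻¹(ℤ_p, p^{-e}ℤ_p; ℤ_p, ℤ_p) = p^{-e} (𝔔_{p^e})₍p₎` (`(𝔔_{p^e})₍p₎ = Φ⁻¹(p^e ℤ_p, ℤ_p; p^e ℤ_p, p^e ℤ_p)`,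
`mem_localAt_atkinLehnerIdeal_iff`). This file proves:

* §1 **`norm_apply_le_of_trace_dual`**: if `trd(x y) ∈ ℤ₍p₎` for all `y ∈ O₍p₎` then `Φ(x) ∈ (ℤ_p, p^{-e}ℤ_p; ℤ_p, ℤ_p)`
  (test against `y` with `Φ(y) ≡ E_{ji}`, resp. `p^e E_{10}`, modulo `p^{e+1}` — density of `Φ(B)` — and compare the
  maximal weighted entry with the error term), hence **`forall_not_dvd_den_reducedTrace_iff_smul_mem_localAt`**:
  `trd(x O₍p₎) ⊆ ℤ₍p₎ ⟺ p^e x ∈ (𝔔_{p^e})₍p₎` — the local dual is `p^{-e}(𝔔_{p^e})₍p₎`;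
* §2 for a Brandt setup `S` of type `(N⁺, N⁻)`, `N = N⁺N⁻`: the global trace condition localises
  (`XiSetup.forall_not_dvd_den_reducedTrace_of_forall`), the ramified local step `q x ∈ (𝔓_q)₍q₎`
  (`XiSetup.smul_mem_localAt_atkinLehnerIdeal_of_dvd`), and
  **`XiSetup.forall_exists_reducedTrace_eq_iff_smul_mem_atkinLehnerIdeal`: `trd(x O) ⊆ ℤ ⟺ N x ∈ 𝔔_N(O)`**, i.e.
  **`O♯ = N⁻¹ 𝔔_N(O) = N⁻¹ O P_{primes(N)}(O)`** (local–global, Voight Cor. 9.4.7, with §1 at `p ∤ N⁻` — at `p ∤ N⁺N⁻` this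
  is the self-duality of `M₂(ℤ_p)` — the ramified dual at `q ∣ N⁻`, and `(𝔔_N)₍p₎ = (𝔔_{p^{v_p N}})₍p₎`); for the trace
  form `T(x, y) = trd(x ȳ)` (Mathlib `LinearMap.BilinForm.dualSubmodule`):
  `XiSetup.mem_dualSubmodule_iff_smul_mem_atkinLehnerIdeal`, **`XiSetup.dualSubmodule_eq_units_inv_smul_atkinLehnerIdeal`:
  `O♯ = ν⁻¹ 𝔔_N`** (`ν = N · 1`), and **the codifferent is invertible** (`O` is Gorenstein):
  `XiSetup.dualSubmodule_mul_atkinLehnerIdeal` — `O♯ 𝔔_N = O = 𝔔_N O♯`, so `diff(O) = (O♯)⁻¹ = 𝔔_N = O P_{primes(N)}(O)`.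
* §3 **`XiSetup.relIndex_localAt_twoSidedIdeal`**: `[O₍r₎ : T_r(O)₍r₎] = r^{2 v_r(N)}` for every prime `r` (a local generator
  `g` of `T_r` has `v_r(nrd g) = v_r(N)` and `[O₍r₎ : g O₍r₎] = r^{2 v_r(nrd g)}`, Voight (16.4.10));
* §4 **`XiSetup.relIndex_atkinLehnerIdeal_of_exactDvd`: `[O : 𝔔_m(O)] = m²` for every exact divisor `m ∥ N`** (indices
  are local, `LatticeLocalGlobal.lean`; `(𝔔_m)₍p₎ = T_p(O)₍p₎` for `p ∣ m`, `= O₍p₎` otherwise); `[O : 𝔔_N] = N²`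
  (`nrd(diff O) = discrd O = N`, Voight (16.8.4));
* §5 **`XiSetup.relIndex_dualSubmodule`: `disc(O) = [O♯ : O] = N² = (N⁺N⁻)²`** (`O♯ = ν⁻¹ 𝔔_N`,
  `[ν⁻¹𝔔_N : O] = [𝔔_N : N O] = [O : N O] / [O : 𝔔_N] = N⁴ / N²`): the reduced discriminant of an Eichler order of level
  `N⁺` in the quaternion algebra of discriminant `N⁻` is `N⁺N⁻` (Voight 23.4.19 «`𝔑 = 𝔇𝔐`»; Vignéras III §5 Cor. 5.3 for
  maximal orders, `QuaternionDiscriminantIndex.lean`).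

## References

* [VignerasLNM800] M.-F. Vignéras, *Arithmétique des algèbres de quaternions*, LNM 800 (1980), Ch. I §4 Lemme 4.1,
  Lemme 4.7; Ch. II §1 Lemme 1.4, Cor. 1.7, §2; Ch. III §5 Cor. 5.3.
* [Voight2021] J. Voight, *Quaternion Algebras*, GTM 288 (2021): Cor. 9.4.7, Lemma 15.6.17, (16.4.10), Def. 16.8.1,
  (16.8.4), 23.3.19, 23.4.12, Prop. 23.4.14, 23.4.19, (23.4.20), Def. 24.2.1.

## Scope (honest)

Theorems only (the trace dual enters through Mathlib's `LinearMap.BilinForm.dualSubmodule` of the form `trd(x ȳ)`; no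
new definition).
-/

noncomputable section

open scoped Pointwise TensorProduct

universe u

namespace Literature.NumberTheory.Automorphic

open AtkinLehner

variable {B : Type u} [Ring B] [Algebra ℚ B] [IsQuaternionAlgebra ℚ B] {O : Submodule ℤ B}

/-! ## §1 The trace dual of the local Eichler order of level `p^e` is `p^{-e} (𝔔_{p^e})₍p₎` -/

section Local

variable {p : ℕ} [hp : Fact p.Prime] {e : ℕ} (Φ : B →ₐ[ℚ] Matrix (Fin 2) (Fin 2) ℚ_[p])
  (hO : IsZOrder O) (hΦ : ∀ y : B, y ∈ localAt p O ↔ IsLevelShape e (Φ y))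

omit [IsQuaternionAlgebra ℚ B] in
/-- `‖p^e‖_p = p^{-e}`. [folklore] -/
private theorem norm_natCast_pow₇₀ (e : ℕ) : ‖((p ^ e : ℕ) : ℚ_[p])‖ = (p : ℝ) ^ (-(e : ℤ)) := by
  rw [Nat.cast_pow, norm_pow, Padic.norm_p, inv_pow, zpow_neg, zpow_natCast]

omit [IsQuaternionAlgebra ℚ B] in
/-- The matrix units `E_{ij}` other than `E_{10}` are level-shaped. [cite: VignerasLNM800, Ch. II §2 (ordres d'Eichler)] -/
private theorem isLevelShape_single₇₀ {i j : Fin 2} (h : ¬ (i = 1 ∧ j = 0)) :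
    IsLevelShape e (Matrix.single i j (1 : ℚ_[p])) := by
  have hp0 : (0 : ℝ) < p := by exact_mod_cast hp.out.pos
  refine ⟨fun k l => ?_, ?_⟩
  · rw [Matrix.single_apply]
    split_ifs <;> simp
  · rw [Matrix.single_apply, if_neg h, norm_zero]
    exact (zpow_pos hp0 _).le

omit [IsQuaternionAlgebra ℚ B] in
/-- `p^e E_{10}` is level-shaped. [cite: VignerasLNM800, Ch. II §2 (ordres d'Eichler)] -/
private theorem isLevelShape_pow_smul_single₇₀ :
    IsLevelShape e (((p ^ e : ℕ) : ℚ_[p]) • Matrix.single (1 : Fin 2) (0 : Fin 2) (1 : ℚ_[p])) := by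
  have hr1 : (p : ℝ) ^ (-(e : ℤ)) ≤ 1 :=
    zpow_le_one_of_nonpos₀ (by exact_mod_cast hp.out.one_lt.le) (by omega)
  have hentry : ∀ k l, ‖(((p ^ e : ℕ) : ℚ_[p]) • Matrix.single (1 : Fin 2) (0 : Fin 2) (1 : ℚ_[p])) k l‖ ≤
      (p : ℝ) ^ (-(e : ℤ)) := by
    intro k l
    rw [Matrix.smul_apply, smul_eq_mul, norm_mul, norm_natCast_pow₇₀, Matrix.single_apply]
    split_ifs
    · rw [norm_one, mul_one]
    · rw [norm_zero, mul_zero]; exact (zpow_pos (by exact_mod_cast hp.out.pos) _).le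
  exact ⟨fun k l => (hentry k l).trans hr1, hentry 1 0⟩

include hΦ in
/-- **The trace dual of the level-`p^e` order is `(ℤ_p, p^{-e}ℤ_p; ℤ_p, ℤ_p)`** (Vignéras II §2 / Voight 23.4.12: the dual of
`(R R; 𝔭^e R)` for the trace form): if `trd(x y) ∈ ℤ₍p₎` for all `y ∈ O₍p₎ = Φ⁻¹(ℤ_p ℤ_p; p^e ℤ_p ℤ_p)`, then the entries
`(0,0), (1,0), (1,1)` of `Φ(x)` are in `ℤ_p` and the entry `(0,1)` is in `p^{-e} ℤ_p`. Proof: with `t` the largest of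
`‖Φ(x)₀₀‖, ‖Φ(x)₁₀‖, ‖Φ(x)₁₁‖, p^{-e}‖Φ(x)₀₁‖`, every level-shaped `M` has `‖tr(Φ(x) M)‖ ≤ max(1, t/p)` (approximate `M` by
`Φ(y)` modulo `p^{e+1}`, so `y ∈ O₍p₎`; the error `tr(Φ(x)(Φ(y) − M))` has norm `≤ t/p`); testing `M = E_{ji}` and
`M = p^e E_{10}` gives `t ≤ max(1, t/p)`, i.e. `t ≤ 1`. [cite: VignerasLNM800, Ch. I §4 Lemme 4.7 and Ch. II §2] -/
theorem norm_apply_le_of_trace_dual {x : B} (h : ∀ y ∈ localAt p O, ¬ p ∣ (reducedTrace ℚ B (x * y)).den) :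
    ‖Φ x 0 0‖ ≤ 1 ∧ ‖Φ x 1 0‖ ≤ 1 ∧ ‖Φ x 1 1‖ ≤ 1 ∧ ‖Φ x 0 1‖ ≤ (p : ℝ) ^ (e : ℤ) := by
  classical
  have hpp : p.Prime := hp.out
  have hp1 : (1 : ℝ) < p := by exact_mod_cast hpp.one_lt
  have hp0 : (0 : ℝ) < p := by positivity
  set X := Φ x with hX
  set r : ℝ := (p : ℝ) ^ (-(e : ℤ)) with hr
  have hr0 : 0 < r := zpow_pos hp0 _
  set t : ℝ := max (max ‖X 0 0‖ ‖X 1 0‖) (max ‖X 1 1‖ (r * ‖X 0 1‖)) with ht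
  have h00 : ‖X 0 0‖ ≤ t := le_max_of_le_left (le_max_left _ _)
  have h10 : ‖X 1 0‖ ≤ t := le_max_of_le_left (le_max_right _ _)
  have h11 : ‖X 1 1‖ ≤ t := le_max_of_le_right (le_max_left _ _)
  have h01 : r * ‖X 0 1‖ ≤ t := le_max_of_le_right (le_max_right _ _)
  have ht0 : 0 ≤ t := (norm_nonneg _).trans h00
  have hs1 : (p : ℝ) ^ (-((e + 1 : ℕ) : ℤ)) ≤ (p : ℝ)⁻¹ := by
    rw [← zpow_neg_one]; exact zpow_le_zpow_right₀ hp1.le (by omega)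
  have hsr : (p : ℝ) ^ (-((e + 1 : ℕ) : ℤ)) ≤ r := zpow_le_zpow_right₀ hp1.le (by push_cast; omega)
  have hs_one : (p : ℝ) ^ (-((e + 1 : ℕ) : ℤ)) ≤ 1 := zpow_le_one_of_nonpos₀ hp1.le (by omega)
  have hre : (p : ℝ) ^ (-((e + 1 : ℕ) : ℤ)) = r * (p : ℝ)⁻¹ := by
    rw [hr, ← zpow_neg_one, ← zpow_add₀ hp0.ne']
    congr 1
    push_cast
    ring
  -- key estimate: `‖tr(X M)‖ ≤ max 1 (t/p)` for every level-shaped `M`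
  have key : ∀ M : Matrix (Fin 2) (Fin 2) ℚ_[p], IsLevelShape e M → ‖(X * M).trace‖ ≤ max 1 (t * (p : ℝ)⁻¹) := by
    intro M hM
    obtain ⟨y, hy⟩ := AlgHom.exists_norm_sub_le Φ M (e + 1)
    set Δ := Φ y - M with hΔ
    have hΦy : Φ y = M + Δ := by rw [hΔ]; abel
    have hsmall : ∀ i j, ‖Δ i j‖ ≤ (p : ℝ) ^ (-((e + 1 : ℕ) : ℤ)) := hy
    have hyO : y ∈ localAt p O := by
      rw [hΦ, hΦy]
      obtain ⟨hM1, hM10⟩ := hM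
      refine ⟨fun i j => ?_, ?_⟩
      · rw [Matrix.add_apply]
        exact (Padic.nonarchimedean _ _).trans (max_le (hM1 i j) ((hsmall i j).trans hs_one))
      · rw [Matrix.add_apply]
        exact (Padic.nonarchimedean _ _).trans (max_le hM10 ((hsmall 1 0).trans hsr))
    have htr : ((reducedTrace ℚ B (x * y) : ℚ) : ℚ_[p]) = (X * M).trace + (X * Δ).trace := by
      rw [ratCast_reducedTrace_mul Φ, hΦy, mul_add, Matrix.trace_add]
    have herr : ‖(X * Δ).trace‖ ≤ t * (p : ℝ)⁻¹ := by
      have hp0' : (0 : ℝ) ≤ (p : ℝ)⁻¹ := inv_nonneg.mpr hp0.le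
      have b1 : ‖X 0 0‖ * ‖Δ 0 0‖ ≤ t * (p : ℝ)⁻¹ := mul_le_mul h00 ((hsmall 0 0).trans hs1) (norm_nonneg _) ht0
      have b2 : ‖X 0 1‖ * ‖Δ 1 0‖ ≤ t * (p : ℝ)⁻¹ := by
        refine (mul_le_mul_of_nonneg_left (hsmall 1 0) (norm_nonneg _)).trans ?_
        rw [hre, ← mul_assoc, mul_comm ‖X 0 1‖ r]
        exact mul_le_mul_of_nonneg_right h01 hp0'
      have b3 : ‖X 1 0‖ * ‖Δ 0 1‖ ≤ t * (p : ℝ)⁻¹ := mul_le_mul h10 ((hsmall 0 1).trans hs1) (norm_nonneg _) ht0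
      have b4 : ‖X 1 1‖ * ‖Δ 1 1‖ ≤ t * (p : ℝ)⁻¹ := mul_le_mul h11 ((hsmall 1 1).trans hs1) (norm_nonneg _) ht0
      rw [Matrix.trace_fin_two, Matrix.mul_apply, Matrix.mul_apply, Fin.sum_univ_two, Fin.sum_univ_two]
      refine (Padic.nonarchimedean _ _).trans (max_le ?_ ?_)
      · exact (Padic.nonarchimedean _ _).trans
          (max_le (by rw [norm_mul]; exact b1) (by rw [norm_mul]; exact b2))
      · exact (Padic.nonarchimedean _ _).trans
          (max_le (by rw [norm_mul]; exact b3) (by rw [norm_mul]; exact b4))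
    have hint : ‖((reducedTrace ℚ B (x * y) : ℚ) : ℚ_[p])‖ ≤ 1 := Padic.norm_ratCast_le_one_iff.mpr (h y hyO)
    have e1 : (X * M).trace = ((reducedTrace ℚ B (x * y) : ℚ) : ℚ_[p]) + -(X * Δ).trace := by rw [htr]; ring
    rw [e1]
    exact (Padic.nonarchimedean _ _).trans (max_le_max hint (by rw [norm_neg]; exact herr))
  -- hence `t ≤ 1`
  have ht1 : t ≤ 1 := by
    by_contra hlt
    push Not at hlt
    have htp : t * (p : ℝ)⁻¹ < t := by
      rw [mul_inv_lt_iff₀ hp0]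
      nlinarith
    have hmax : max 1 (t * (p : ℝ)⁻¹) < t := max_lt hlt htp
    have htest : ∀ M : Matrix (Fin 2) (Fin 2) ℚ_[p], IsLevelShape e M → ‖(X * M).trace‖ ≠ t :=
      fun M hM hMt => (lt_irrefl t) (lt_of_le_of_lt (hMt ▸ key M hM) hmax)
    rcases max_choice (max ‖X 0 0‖ ‖X 1 0‖) (max ‖X 1 1‖ (r * ‖X 0 1‖)) with hA | hB
    · rcases max_choice ‖X 0 0‖ ‖X 1 0‖ with h1 | h2
      · exact htest _ (isLevelShape_single₇₀ (i := 0) (j := 0) (by decide))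
          (by rw [Matrix.trace_mul_single_fin_two X 0 0, ht, hA, h1])
      · exact htest _ (isLevelShape_single₇₀ (i := 0) (j := 1) (by decide))
          (by rw [Matrix.trace_mul_single_fin_two X 1 0, ht, hA, h2])
    · rcases max_choice ‖X 1 1‖ (r * ‖X 0 1‖) with h3 | h4
      · exact htest _ (isLevelShape_single₇₀ (i := 1) (j := 1) (by decide))
          (by rw [Matrix.trace_mul_single_fin_two X 1 1, ht, hB, h3])
      · refine htest _ isLevelShape_pow_smul_single₇₀ ?_
        rw [Matrix.mul_smul, Matrix.trace_smul, smul_eq_mul, norm_mul, norm_natCast_pow₇₀,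
          Matrix.trace_mul_single_fin_two X 0 1, ht, hB, h4]
  refine ⟨h00.trans ht1, h10.trans ht1, h11.trans ht1, ?_⟩
  have h01' : ‖X 0 1‖ ≤ t / r := by rw [le_div_iff₀ hr0, mul_comm]; exact h01
  refine h01'.trans ?_
  rw [div_le_iff₀ hr0, hr, ← zpow_add₀ hp0.ne', add_neg_cancel, zpow_zero]
  exact ht1

include hΦ in
/-- **`trd(x O₍p₎) ⊆ ℤ₍p₎ ⟹ Φ(p^e x)` has Atkin–Lehner shape** (`p^e (ℤ_p, p^{-e}ℤ_p; ℤ_p, ℤ_p) = (p^e ℤ_p, ℤ_p; p^e ℤ_p, p^e ℤ_p)`).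
[cite: VignerasLNM800, Ch. I §4 Lemme 4.7 and Ch. II §2] -/
theorem isALShape_smul_of_trace_dual {x : B} (h : ∀ y ∈ localAt p O, ¬ p ∣ (reducedTrace ℚ B (x * y)).den) :
    IsALShape e (Φ (((p ^ e : ℕ) : ℤ) • x)) := by
  have hp0 : (0 : ℝ) < p := by exact_mod_cast hp.out.pos
  obtain ⟨h00, h10, h11, h01⟩ := norm_apply_le_of_trace_dual Φ hΦ h
  have hsm : ∀ i j, Φ (((p ^ e : ℕ) : ℤ) • x) i j = ((p ^ e : ℕ) : ℚ_[p]) * Φ x i j := fun i j => by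
    rw [map_zsmul, Matrix.smul_apply, zsmul_eq_mul, Int.cast_natCast]
  have hentry : ∀ i j, ‖Φ (((p ^ e : ℕ) : ℤ) • x) i j‖ = (p : ℝ) ^ (-(e : ℤ)) * ‖Φ x i j‖ := fun i j => by
    rw [hsm, norm_mul, norm_natCast_pow₇₀]
  refine ⟨?_, ?_, ?_, ?_⟩ <;> rw [hentry]
  · exact (mul_le_mul_of_nonneg_left h00 (zpow_pos hp0 _).le).trans (mul_one _).le
  · calc (p : ℝ) ^ (-(e : ℤ)) * ‖Φ x 0 1‖ ≤ (p : ℝ) ^ (-(e : ℤ)) * (p : ℝ) ^ (e : ℤ) :=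
          mul_le_mul_of_nonneg_left h01 (zpow_pos hp0 _).le
      _ = 1 := by rw [← zpow_add₀ hp0.ne', neg_add_cancel, zpow_zero]
  · exact (mul_le_mul_of_nonneg_left h10 (zpow_pos hp0 _).le).trans (mul_one _).le
  · exact (mul_le_mul_of_nonneg_left h11 (zpow_pos hp0 _).le).trans (mul_one _).le

include hO hΦ in
/-- **The local trace dual of the level-`p^e` Eichler order is `p^{-e} (𝔔_{p^e})₍p₎`**: for every `x ∈ B`,
`trd(x y) ∈ ℤ₍p₎` for all `y ∈ O₍p₎` iff `p^e x ∈ (𝔔_{p^e})₍p₎` (`⇒`: the dual shape; `⇐`: `tr(X Y) ∈ p^e ℤ_p` for `X`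
Atkin–Lehner-shaped and `Y` level-shaped, `AtkinLehner.norm_trace_mul_le`). With Voight 23.4.12–23.4.14: `O_p♯ = p^{-e} O_p ϖ`,
`[O_p♯ : O_p] = p^{2e} = disc`. [cite: Voight2021, 23.4.12, Prop. 23.4.14 and Lemma 15.6.17] -/
theorem forall_not_dvd_den_reducedTrace_iff_smul_mem_localAt (x : B) :
    (∀ y ∈ localAt p O, ¬ p ∣ (reducedTrace ℚ B (x * y)).den) ↔
      ((p ^ e : ℕ) : ℤ) • x ∈ localAt p (atkinLehnerIdeal O (p ^ e)) := by
  refine ⟨fun h => mem_localAt_of_isALShape Φ hO hΦ (isALShape_smul_of_trace_dual Φ hΦ h), fun hx y hy => ?_⟩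
  have hX := isALShape_of_mem_localAt Φ hΦ hx
  have hY : IsLevelShape e (Φ y) := (hΦ y).mp hy
  have hle := norm_trace_mul_le hX hY
  -- `tr(Φ(p^e x) Φ(y)) = p^e · trd(x y)`
  have e1 : ((reducedTrace ℚ B ((((p ^ e : ℕ) : ℤ) • x) * y) : ℚ) : ℚ_[p]) =
      ((p ^ e : ℕ) : ℚ_[p]) * ((reducedTrace ℚ B (x * y) : ℚ) : ℚ_[p]) := by
    rw [smul_mul_assoc, map_zsmul, zsmul_eq_mul]
    push_cast
    ring
  rw [← ratCast_reducedTrace_mul Φ, e1, norm_mul, norm_natCast_pow₇₀] at hle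
  have hp0 : (0 : ℝ) < (p : ℝ) ^ (-(e : ℤ)) := zpow_pos (by exact_mod_cast hp.out.pos) _
  have h1 : ‖((reducedTrace ℚ B (x * y) : ℚ) : ℚ_[p])‖ ≤ 1 := by
    by_contra hgt
    push Not at hgt
    have := mul_lt_mul_of_pos_left hgt hp0
    rw [mul_one] at this
    exact absurd hle (not_le.mpr this)
  exact Padic.norm_ratCast_le_one_iff.mp h1

end Local

/-! ## §2 Brandt setups: the trace dual of the Eichler order is `N⁻¹ 𝔔_N(O)`, `N = N⁺N⁻` -/

namespace Brandt

variable {Nplus Nminus : ℕ} (S : XiSetup Nplus Nminus)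

/-- `N⁺N⁻ ≠ 0`. [folklore] -/
private theorem XiSetup.level_ne_zero₇₀ (S : XiSetup Nplus Nminus) : Nplus * Nminus ≠ 0 :=
  mul_ne_zero S.nplus_ne_zero S.squarefree.ne_zero

/-- `v_r(N⁺N⁻) = v_r(N⁺)` at `r ∤ N⁻`. [folklore] -/
private theorem XiSetup.factorization_level_of_not_dvd₇₀ (S : XiSetup Nplus Nminus) {r : ℕ} (hr : ¬ r ∣ Nminus) :
    (Nplus * Nminus).factorization r = Nplus.factorization r := by
  rw [Nat.factorization_mul S.nplus_ne_zero S.squarefree.ne_zero, Finsupp.add_apply,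
    Nat.factorization_eq_zero_of_not_dvd hr, add_zero]

/-- `v_q(N⁺N⁻) = 1` at a prime `q ∣ N⁻`. [folklore] -/
private theorem XiSetup.factorization_level_of_dvd₇₀ (S : XiSetup Nplus Nminus) {q : ℕ} (hq : q.Prime)
    (hqN : q ∣ Nminus) : (Nplus * Nminus).factorization q = 1 := by
  have h1 : Nplus.factorization q = 0 := Nat.factorization_eq_zero_of_not_dvd fun h =>
    hq.one_lt.ne' ((S.coprime.coprime_dvd_left h).eq_one_of_dvd hqN)
  have h2 : Nminus.factorization q = 1 :=
    le_antisymm (S.squarefree.natFactorization_le_one q) ((hq.dvd_iff_one_le_factorization S.squarefree.ne_zero).mp hqN)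
  rw [Nat.factorization_mul S.nplus_ne_zero S.squarefree.ne_zero, Finsupp.add_apply, h1, h2, zero_add]

/-- A central unit `ν = n · 1` acts as the integer `n`: `ν J = n J`. [folklore] -/
private theorem units_smul_eq_natCast_smul₇₀ {D : Type u} [Ring D] {ν : Dˣ} {n : ℕ} (hν : (ν : D) = (n : ℤ))
    (J : Submodule ℤ D) : ν • J = (n : ℤ) • J := by
  ext x
  constructor
  · intro hx
    obtain ⟨y, hy, rfl⟩ := exists_eq_zsmul_of_mem_units_smul hν hx
    exact Submodule.smul_mem_pointwise_smul y _ J hy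
  · intro hx
    obtain ⟨y, hy, rfl⟩ := (Submodule.mem_smul_pointwise_iff_exists x _ J).mp hx
    exact units_smul_eq_zsmul_of_val_eq hν J hy

/-- **The global trace condition localises**: if `trd(x O) ⊆ ℤ` then `trd(x O₍p₎) ⊆ ℤ₍p₎` for every prime `p`.
[cite: Voight2021, Cor. 9.4.7 and Lemma 15.6.17] -/
theorem XiSetup.forall_not_dvd_den_reducedTrace_of_forall {x : S.D}
    (h : ∀ y ∈ S.O, ∃ n : ℤ, reducedTrace ℚ S.D (x * y) = n) {p : ℕ} [Fact p.Prime] :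
    ∀ y ∈ localAt p S.O, ¬ p ∣ (reducedTrace ℚ S.D (x * y)).den := by
  rintro y ⟨m, hm0, hmp, hmy⟩
  obtain ⟨n, hn⟩ := h _ hmy
  rw [mul_smul_comm, map_zsmul, zsmul_eq_mul, Int.cast_natCast] at hn
  exact not_dvd_den_of_natCast_pow_mul_eq_intCast hm0 hmp (k := 1) (by rw [pow_one]; exact hn)

/-- **The ramified local step**: at `q ∣ N⁻`, if `trd(x O₍q₎) ⊆ ℤ₍q₎` then `q x ∈ (𝔔_q)₍q₎ = (𝔓_q)₍q₎` (the dual of the maximal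
order `O₍q₎` is `π⁻¹ O₍q₎`, Vignéras II §1 Cor. 1.7, so `v_q(nrd x) ≥ -1` and `v_q(nrd(q x)) ≥ 1`).
[cite: VignerasLNM800, Ch. II §1 Lemme 1.4 and Cor. 1.7] -/
theorem XiSetup.smul_mem_localAt_atkinLehnerIdeal_of_dvd {q : ℕ} [Fact q.Prime] (hq : q ∣ Nminus) {x : S.D}
    (h : ∀ y ∈ localAt q S.O, ¬ q ∣ (reducedTrace ℚ S.D (x * y)).den) :
    (q : ℤ) • x ∈ localAt q (atkinLehnerIdeal S.O q) := by
  have hqq : q.Prime := Fact.out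
  have hdivp := S.hdiv_of_dvd hq
  have hdiv : ∀ z : S.D, z ≠ 0 → IsUnit z := forall_isUnit_of_padic_division hdivp
  have hOp := S.maximalAt_of_dvd hq
  have hΛ : ∀ z : S.D, z ∈ localAt q S.O ↔ ¬ q ∣ (reducedNorm ℚ S.D z).den := fun z =>
    (hOp z).trans ⟨fun h => h.1, fun h => ⟨h, not_dvd_den_reducedTrace_of_not_dvd_den_reducedNorm hdivp h⟩⟩
  have hT : ∀ y : ℚ_[q] ⊗[ℚ] S.D, y ≠ 0 → IsUnit y := S.hdiv_of_dvd hq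
  by_cases hx0 : x = 0
  · rw [hx0, smul_zero]; exact Submodule.zero_mem _
  obtain ⟨π, -, hπ⟩ := exists_uniformizer_of_ramified hdiv S.isZOrder_O hΛ
  have hx := (forall_not_dvd_den_reducedTrace_iff_of_ramified hdiv S.isZOrder_O hΛ hT π hπ x).mp h
  rw [S.atkinLehnerIdeal_eq_normPrimeIdeal hq, mem_localAt_normPrimeIdeal_iff hdivp S.isZOrder_O]
  rcases (mem_units_smul_localAt_iff_of_ramified hdiv hΛ π⁻¹ x).mp hx with h0 | hval
  · exact absurd h0 hx0
  rw [reducedNorm_units_inv, padicValRat.inv, hπ] at hval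
  -- `hval : -1 ≤ v_q(nrd x)`; `nrd(q x) = q² nrd x`
  have hn0 : reducedNorm ℚ S.D x ≠ 0 := reducedNorm_ne_zero_of_ne_zero hdiv hx0
  have hqQ : (q : ℚ) ≠ 0 := by exact_mod_cast hqq.ne_zero
  have hnrd : reducedNorm ℚ S.D ((q : ℤ) • x) = (q : ℚ) * ((q : ℚ) * reducedNorm ℚ S.D x) := by
    rw [reducedNorm_zsmul]; push_cast; ring
  have hqn0 : (q : ℚ) * reducedNorm ℚ S.D x ≠ 0 := mul_ne_zero hqQ hn0
  have hv2 : padicValRat q (reducedNorm ℚ S.D ((q : ℤ) • x)) = 2 + padicValRat q (reducedNorm ℚ S.D x) := by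
    rw [hnrd, padicValRat.mul hqQ hqn0, padicValRat.mul hqQ hn0, padicValRat.self hqq.one_lt]
    ring
  have hv1 : padicValRat q (reducedNorm ℚ S.D ((q : ℤ) • x) / q) = 1 + padicValRat q (reducedNorm ℚ S.D x) := by
    rw [hnrd, mul_div_assoc, mul_div_cancel_left₀ _ hqQ, padicValRat.mul hqQ hn0, padicValRat.self hqq.one_lt]
  refine ⟨(hΛ _).mpr (not_dvd_den_iff_padicValRat_nonneg.mpr (by rw [hv2]; omega)),
    not_dvd_den_iff_padicValRat_nonneg.mpr (by rw [hv1]; omega)⟩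

/-- **The trace dual (codifferent) of an Eichler order is `N⁻¹ 𝔔_N(O)`, `N = N⁺N⁻`**: for every Brandt setup `S` of type
`(N⁺, N⁻)` and every `x ∈ D`, `trd(x y) ∈ ℤ` for all `y ∈ O` iff `N x ∈ 𝔔_N(O) = O P_{primes(N)}(O)`. Proof: `⇐` is
`trd(𝔔_N O) ⊆ N ℤ`; `⇒` is local (Voight Cor. 9.4.7): at `p ∤ N⁻` the local dual of the level-`p^{v_p N⁺}` model is
`p^{-v_p N⁺}(𝔔_{p^{v_p N⁺}})₍p₎` (§1; at `p ∤ N⁺N⁻` this is self-duality of `M₂(ℤ_p)`), at `q ∣ N⁻` it is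
`q^{-1}(𝔓_q)₍q₎`, and `(𝔔_N)₍p₎ = (𝔔_{p^{v_p N}})₍p₎`. With Lemma 15.6.17 (`disc O = [O♯ : O]`), 16.8 (`diff O = codiff(O)⁻¹`)
and 23.4.19 (`discrd O = 𝔇𝔐 = N`). [cite: Voight2021, Lemma 15.6.17, 23.4.12, 23.4.19 and (23.4.20)]
[cite: VignerasLNM800, Ch. I §4 Lemme 4.7, Ch. II §1 Cor. 1.7 and Ch. II §2] -/
theorem XiSetup.forall_exists_reducedTrace_eq_iff_smul_mem_atkinLehnerIdeal (x : S.D) :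
    (∀ y ∈ S.O, ∃ n : ℤ, reducedTrace ℚ S.D (x * y) = n) ↔
      ((Nplus * Nminus : ℕ) : ℤ) • x ∈ atkinLehnerIdeal S.O (Nplus * Nminus) := by
  have hN := S.level_ne_zero₇₀
  constructor
  · intro h
    refine mem_of_forall_prime_mem_localAt fun p hp => ?_
    haveI : Fact p.Prime := ⟨hp⟩
    have hloc := S.forall_not_dvd_den_reducedTrace_of_forall h (p := p)
    rw [localAt_atkinLehnerIdeal_eq_localAt_ordProj S.O hN hp]
    have hsplit : ((Nplus * Nminus : ℕ) : ℤ) • x =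
        ((ordCompl[p] (Nplus * Nminus) : ℕ) : ℤ) • ((((p ^ (Nplus * Nminus).factorization p : ℕ)) : ℤ) • x) := by
      rw [smul_smul, ← Nat.cast_mul, mul_comm (ordCompl[p] (Nplus * Nminus)), Nat.ordProj_mul_ordCompl_eq_self]
    rw [hsplit]
    refine Submodule.smul_mem _ _ ?_
    by_cases hpN : p ∣ Nminus
    · rw [S.factorization_level_of_dvd₇₀ hp hpN, pow_one]
      exact S.smul_mem_localAt_atkinLehnerIdeal_of_dvd hpN hloc
    · obtain ⟨Φ, hΦ⟩ := S.exists_isLevelShape_iff S.nplus_ne_zero hpN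
      rw [S.factorization_level_of_not_dvd₇₀ hpN]
      exact (forall_not_dvd_den_reducedTrace_iff_smul_mem_localAt Φ S.isZOrder_O hΦ x).mp hloc
  · intro h y hy
    obtain ⟨n, hn⟩ := h.2 y hy
    refine ⟨n, ?_⟩
    rw [smul_mul_assoc, map_zsmul, zsmul_eq_mul, Int.cast_natCast] at hn
    exact mul_left_cancel₀ (by exact_mod_cast hN) hn

/-- **`O♯ = N⁻¹ 𝔔_N` for the trace form `T(x, y) = trd(x ȳ)`**: `x ∈ T.dualSubmodule O ↔ N x ∈ 𝔔_N(O)` (`O` is stable under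
the standard involution, so the duals for `trd(x y)` and `trd(x ȳ)` agree). [cite: Voight2021, Lemma 15.6.17 and 23.4.19] -/
theorem XiSetup.mem_dualSubmodule_iff_smul_mem_atkinLehnerIdeal (T : LinearMap.BilinForm ℚ S.D)
    (hT : ∀ x y, T x y = reducedTrace ℚ S.D (x * standardInvolution ℚ S.D y)) (x : S.D) :
    x ∈ T.dualSubmodule S.O ↔ ((Nplus * Nminus : ℕ) : ℤ) • x ∈ atkinLehnerIdeal S.O (Nplus * Nminus) := by
  rw [← S.forall_exists_reducedTrace_eq_iff_smul_mem_atkinLehnerIdeal, LinearMap.BilinForm.mem_dualSubmodule]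
  have hO := S.isZOrder_O
  constructor
  · intro h y hy
    obtain ⟨n, hn⟩ := Submodule.mem_one.mp (h _ (hO.toIsOrder.standardInvolution_mem hy))
    refine ⟨n, ?_⟩
    rw [hT, standardInvolution_standardInvolution] at hn
    rw [← hn]
    simp
  · intro h y hy
    obtain ⟨n, hn⟩ := h _ (hO.toIsOrder.standardInvolution_mem hy)
    rw [hT, Submodule.mem_one]
    exact ⟨n, by rw [hn]; simp⟩

/-- **`T.dualSubmodule O = ν⁻¹ 𝔔_N(O)`** as lattices, `ν = N · 1 ∈ D^×` (`N = N⁺N⁻`). [cite: Voight2021, Lemma 15.6.17 and 23.4.19] -/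
theorem XiSetup.dualSubmodule_eq_units_inv_smul_atkinLehnerIdeal (T : LinearMap.BilinForm ℚ S.D)
    (hT : ∀ x y, T x y = reducedTrace ℚ S.D (x * standardInvolution ℚ S.D y)) {ν : S.Dˣ}
    (hν : (ν : S.D) = ((Nplus * Nminus : ℕ) : ℤ)) :
    T.dualSubmodule S.O = ν⁻¹ • atkinLehnerIdeal S.O (Nplus * Nminus) := by
  ext x
  rw [S.mem_dualSubmodule_iff_smul_mem_atkinLehnerIdeal T hT, mem_units_smul_submodule_iff, inv_inv, Units.smul_def, hν,
    Int.cast_smul_eq_zsmul]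

/-- **`N · O♯ = 𝔔_N(O)`** (`N = N⁺N⁻`): the codifferent scaled by the reduced discriminant is the Atkin–Lehner ideal of the
full level. [cite: Voight2021, Lemma 15.6.17, (16.8.4) and 23.4.19] -/
theorem XiSetup.natCast_smul_dualSubmodule_eq_atkinLehnerIdeal (T : LinearMap.BilinForm ℚ S.D)
    (hT : ∀ x y, T x y = reducedTrace ℚ S.D (x * standardInvolution ℚ S.D y)) :
    ((Nplus * Nminus : ℕ) : ℤ) • T.dualSubmodule S.O = atkinLehnerIdeal S.O (Nplus * Nminus) := by
  obtain ⟨ν, hν, -⟩ := exists_units_val_eq_natCast (D := S.D) S.level_ne_zero₇₀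
  rw [S.dualSubmodule_eq_units_inv_smul_atkinLehnerIdeal T hT hν, ← units_smul_eq_natCast_smul₇₀ hν, smul_inv_smul]

/-- **The codifferent of an Eichler order is invertible** (`O` is Gorenstein, Voight Def. 24.2.1): with `O♯ = ν⁻¹ 𝔔_N` and
`𝔔_N 𝔔_N = N O`, **`O♯ · 𝔔_N = O`** and **`𝔔_N · O♯ = O`** — the different `diff(O) = (O♯)⁻¹` is `𝔔_N = O P_{primes(N)}(O)`,
of reduced norm `N = discrd O` (Voight (16.8.4)). [cite: Voight2021, Def. 16.8.1, (16.8.4), Def. 24.2.1 and (23.4.20)] -/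
theorem XiSetup.dualSubmodule_mul_atkinLehnerIdeal (T : LinearMap.BilinForm ℚ S.D)
    (hT : ∀ x y, T x y = reducedTrace ℚ S.D (x * standardInvolution ℚ S.D y)) :
    T.dualSubmodule S.O * atkinLehnerIdeal S.O (Nplus * Nminus) = S.O ∧
      atkinLehnerIdeal S.O (Nplus * Nminus) * T.dualSubmodule S.O = S.O := by
  have hN := S.level_ne_zero₇₀
  obtain ⟨ν, hν, -⟩ := exists_units_val_eq_natCast (D := S.D) hN
  have hsq := S.atkinLehnerIdeal_mul_self_of_exactDvd (dvd_refl (Nplus * Nminus))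
    (by rw [Nat.div_self (Nat.pos_of_ne_zero hN)]; exact Nat.coprime_one_right _)
  have hdual := S.dualSubmodule_eq_units_inv_smul_atkinLehnerIdeal T hT hν
  refine ⟨?_, ?_⟩
  · rw [hdual, smul_mul_assoc, hsq, ← units_smul_eq_natCast_smul₇₀ hν, inv_smul_smul]
  · -- multiply by the central unit `ν = N`: `N (𝔔_N O♯) = 𝔔_N (N O♯) = 𝔔_N 𝔔_N = N O`
    have h1 := S.natCast_smul_dualSubmodule_eq_atkinLehnerIdeal T hT
    have h2 : ν • (atkinLehnerIdeal S.O (Nplus * Nminus) * T.dualSubmodule S.O) = ν • S.O := by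
      rw [units_smul_eq_natCast_smul₇₀ hν, units_smul_eq_natCast_smul₇₀ hν, ← mul_smul_comm, h1, hsq]
    exact smul_left_cancel_iff ν |>.mp h2

/-- On the primes of an exact divisor `m ∥ N` the factorizations of `m` and `N` agree. [folklore] -/
private theorem factorization_eq_of_exactDvd₇₀ {m N : ℕ} (hN : N ≠ 0) (hm : m ∣ N) (hcop : m.Coprime (N / m)) {r : ℕ}
    (hr : r ∈ m.primeFactors) : N.factorization r = m.factorization r := by
  have hm0 : m ≠ 0 := ne_zero_of_dvd_ne_zero hN hm
  have hq0 : N / m ≠ 0 := fun h => hN (by rw [← Nat.mul_div_cancel' hm, h, mul_zero])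
  have hrp : r.Prime := Nat.prime_of_mem_primeFactors hr
  have hrm : r ∣ m := Nat.dvd_of_mem_primeFactors hr
  conv_lhs => rw [← Nat.mul_div_cancel' hm]
  rw [Nat.factorization_mul hm0 hq0, Finsupp.add_apply,
    Nat.factorization_eq_zero_of_not_dvd ((Nat.Prime.coprime_iff_not_dvd hrp).mp (hcop.coprime_dvd_left hrm)), add_zero]

/-! ## §3 The local index of the admissible ideal `T_r(O)` -/

/-- **`[O₍r₎ : T_r(O)₍r₎] = r^{2 v_r(N⁺N⁻)}`** for every prime `r`: `T_r(O)₍r₎ = g O₍r₎` for a local generator `g` with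
`v_r(nrd g) = v_r(N⁺N⁻)` (`1` at `r ∣ N⁻`, `v_r(N⁺)` at `r ∤ N⁻`), and `[O₍r₎ : g O₍r₎] = r^{2 v_r(nrd g)}`.
[cite: Voight2021, 16.4.10, 23.3.19 and Prop. 23.4.14] -/
theorem XiSetup.relIndex_localAt_twoSidedIdeal {r : ℕ} (hr : r.Prime) :
    (localAt r (S.twoSidedIdeal S.O r)).toAddSubgroup.relIndex (localAt r S.O).toAddSubgroup =
      r ^ (2 * (Nplus * Nminus).factorization r) := by
  haveI : Fact r.Prime := ⟨hr⟩
  obtain ⟨g, hg, hloc, hv⟩ := S.exists_generator_twoSidedIdeal (r := r)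
  obtain ⟨k, hk, hidx⟩ := exists_relIndex_units_smul_localAt_eq_pow (p := r) S.isZOrder_O g
    (le_localAt r S.O (S.twoSidedIdeal_le S.O r hg))
  rw [hloc, hidx]
  have hk' : (k : ℤ) = ((if r ∣ Nminus then 1 else Nplus.factorization r : ℕ) : ℤ) := by
    rw [← hv, ← hk]
  have hk'' : k = (if r ∣ Nminus then 1 else Nplus.factorization r) := by exact_mod_cast hk'
  rw [hk'']
  split_ifs with h
  · rw [S.factorization_level_of_dvd₇₀ hr h]
  · rw [S.factorization_level_of_not_dvd₇₀ h]

/-! ## §4 `[O : 𝔔_m(O)] = m²` for exact divisors -/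

/-- The primes of the increasing enumeration of `primes(m)` are primes. [folklore] -/
private theorem prime_of_mem_sort_primeFactors₇₀ {m : ℕ} : ∀ r ∈ m.primeFactors.sort (· ≤ ·), r.Prime :=
  fun _ hr => Nat.prime_of_mem_primeFactors ((Finset.mem_sort _).mp hr)

/-- `[O : 𝔔_m(O)] ≠ 0` (`m O ⊆ 𝔔_m` and `[O : m O] = m⁴`). [cite: VignerasLNM800, Ch. I §4 Lemme 4.1 and Lemme 4.7] -/
theorem XiSetup.relIndex_atkinLehnerIdeal_ne_zero_of_ne_zero {m : ℕ} (hm0 : m ≠ 0) :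
    (atkinLehnerIdeal S.O m).toAddSubgroup.relIndex S.O.toAddSubgroup ≠ 0 := by
  intro h0
  have hsub : (((m : ℤ) • S.O : Submodule ℤ S.D)).toAddSubgroup ≤ (atkinLehnerIdeal S.O m).toAddSubgroup :=
    Submodule.toAddSubgroup_mono (smul_le_atkinLehnerIdeal S.isZOrder_O)
  have h := AddSubgroup.relIndex_eq_zero_of_le_left hsub h0
  rw [relIndex_intCast_smul_eq S.isZOrder_O (by exact_mod_cast hm0 : (m : ℤ) ≠ 0), Int.natAbs_natCast] at h
  exact pow_ne_zero 4 hm0 h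

/-- **`[O : 𝔔_m(O)] = m²` for every exact divisor `m ∥ N⁺N⁻`** (the reduced norm of the invertible two-sided ideal `𝔔_m` is
`m`): the index is the product of its localisations, `[O₍p₎ : T_p(O)₍p₎] = p^{2 v_p(N)} = p^{2 v_p(m)}` at `p ∣ m` and `1` at
`p ∤ m`. [cite: Voight2021, 16.4.10, Prop. 23.4.14 and (16.8.4)] -/
theorem XiSetup.relIndex_atkinLehnerIdeal_of_exactDvd {m : ℕ} (hm : m ∣ Nplus * Nminus)
    (hcop : m.Coprime (Nplus * Nminus / m)) :
    (atkinLehnerIdeal S.O m).toAddSubgroup.relIndex S.O.toAddSubgroup = m ^ 2 := by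
  have hO := S.isZOrder_O
  have hN := S.level_ne_zero₇₀
  have hm0 : m ≠ 0 := ne_zero_of_dvd_ne_zero hN hm
  have hn0 := S.relIndex_atkinLehnerIdeal_ne_zero_of_ne_zero hm0
  refine Nat.eq_of_factorization_eq hn0 (pow_ne_zero 2 hm0) fun p => ?_
  rw [Nat.factorization_pow, Finsupp.smul_apply, smul_eq_mul]
  by_cases hp : p.Prime
  · haveI : Fact p.Prime := ⟨hp⟩
    have hloc := relIndex_localAt S.O (atkinLehnerIdeal S.O m) (atkinLehnerIdeal_le S.O m) (p := p) hn0
    have hQl : localAt p (atkinLehnerIdeal S.O m) =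
        localAt p (if p ∈ m.primeFactors.sort (· ≤ ·) then S.twoSidedIdeal S.O p else S.O) := by
      rw [S.atkinLehnerIdeal_eq_order_mul_twoSidedIdealProd hm hcop,
        S.localAt_order_mul_twoSidedIdealProd hO prime_of_mem_sort_primeFactors₇₀ (Finset.sort_nodup _ _) hp]
    rw [hQl] at hloc
    by_cases hpm : p ∈ m.primeFactors.sort (· ≤ ·)
    · rw [if_pos hpm, S.relIndex_localAt_twoSidedIdeal hp] at hloc
      rw [← Nat.pow_right_injective hp.two_le hloc,
        factorization_eq_of_exactDvd₇₀ hN hm hcop ((Finset.mem_sort _).mp hpm)]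
    · rw [if_neg hpm, AddSubgroup.relIndex_self] at hloc
      have h0 : ((atkinLehnerIdeal S.O m).toAddSubgroup.relIndex S.O.toAddSubgroup).factorization p = 0 :=
        (Nat.pow_right_injective hp.two_le (hloc.symm.trans (pow_zero p).symm))
      have hmp : m.factorization p = 0 := Nat.factorization_eq_zero_of_not_dvd fun h =>
        hpm ((Finset.mem_sort _).mpr (Nat.mem_primeFactors.mpr ⟨hp, h, hm0⟩))
      rw [h0, hmp, mul_zero]
  · rw [Nat.factorization_eq_zero_of_not_prime _ hp, Nat.factorization_eq_zero_of_not_prime _ hp, mul_zero]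

/-- **`[O : 𝔔_N(O)] = N²`, `N = N⁺N⁻`** (the different has reduced norm `discrd O = N`, Voight (16.8.4)).
[cite: Voight2021, (16.8.4), 23.4.12 and 23.4.19] -/
theorem XiSetup.relIndex_atkinLehnerIdeal_level :
    (atkinLehnerIdeal S.O (Nplus * Nminus)).toAddSubgroup.relIndex S.O.toAddSubgroup = (Nplus * Nminus) ^ 2 :=
  S.relIndex_atkinLehnerIdeal_of_exactDvd dvd_rfl
    (by rw [Nat.div_self (Nat.pos_of_ne_zero S.level_ne_zero₇₀)]; exact Nat.coprime_one_right _)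

/-! ## §5 The discriminant `[O♯ : O] = (N⁺N⁻)²` -/

/-- **`disc(O) = [O♯ : O] = (N⁺N⁻)²` for the Eichler order of every Brandt setup** (`O♯` the trace dual for
`T(x, y) = trd(x ȳ)`): `O♯ = ν⁻¹ 𝔔_N` (§2), `[ν⁻¹ 𝔔_N : O] = [𝔔_N : N O]`, and
`[O : N O] = [O : 𝔔_N] · [𝔔_N : N O] = N⁴` with `[O : 𝔔_N] = N²` — the reduced discriminant of an Eichler order of level `N⁺`
in the quaternion algebra of discriminant `N⁻` is `N⁺N⁻` (Voight 23.4.19: `discrd O = 𝔇𝔐`; Lemma 15.6.17: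
`disc O = [codiff(O) : O]`). [cite: Voight2021, Lemma 15.6.17, 23.4.12 and 23.4.19]
[cite: VignerasLNM800, Ch. I §4 Lemme 4.7 and Ch. III §5 Cor. 5.3] -/
theorem XiSetup.relIndex_dualSubmodule (T : LinearMap.BilinForm ℚ S.D)
    (hT : ∀ x y, T x y = reducedTrace ℚ S.D (x * standardInvolution ℚ S.D y)) :
    S.O.toAddSubgroup.relIndex (T.dualSubmodule S.O).toAddSubgroup = (Nplus * Nminus) ^ 2 := by
  have hO := S.isZOrder_O
  have hN := S.level_ne_zero₇₀
  obtain ⟨ν, hν, -⟩ := exists_units_val_eq_natCast (D := S.D) hN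
  have hdual := S.dualSubmodule_eq_units_inv_smul_atkinLehnerIdeal T hT hν
  -- `[ν⁻¹ 𝔔_N : O] = [𝔔_N : ν O]`
  have hinj : Function.Injective (AddMonoidHom.mulLeft (ν : S.D)) := fun a b hab => by
    simpa using congrArg (fun w => ((ν⁻¹ : S.Dˣ) : S.D) * w) hab
  have h := AddSubgroup.relIndex_map_map_of_injective (f := AddMonoidHom.mulLeft (ν : S.D))
    S.O.toAddSubgroup (ν⁻¹ • atkinLehnerIdeal S.O (Nplus * Nminus)).toAddSubgroup hinj
  rw [← units_smul_toAddSubgroup_eq_map, ← units_smul_toAddSubgroup_eq_map, smul_smul, mul_inv_cancel, one_smul] at h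
  rw [hdual, ← h, units_smul_eq_natCast_smul₇₀ hν]
  -- `[𝔔_N : N O] · [O : 𝔔_N] = [O : N O] = N⁴`
  have hle₁ : (((Nplus * Nminus : ℕ) : ℤ) • S.O).toAddSubgroup ≤ (atkinLehnerIdeal S.O (Nplus * Nminus)).toAddSubgroup :=
    Submodule.toAddSubgroup_mono (smul_le_atkinLehnerIdeal hO)
  have hle₂ : (atkinLehnerIdeal S.O (Nplus * Nminus)).toAddSubgroup ≤ S.O.toAddSubgroup :=
    Submodule.toAddSubgroup_mono (atkinLehnerIdeal_le S.O _)
  have hmul := AddSubgroup.relIndex_mul_relIndex _ _ _ hle₁ hle₂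
  rw [S.relIndex_atkinLehnerIdeal_level, relIndex_intCast_smul_eq hO (by exact_mod_cast hN : ((Nplus * Nminus : ℕ) : ℤ) ≠ 0),
    Int.natAbs_natCast, show (Nplus * Nminus) ^ 4 = (Nplus * Nminus) ^ 2 * (Nplus * Nminus) ^ 2 by ring] at hmul
  exact Nat.eq_of_mul_eq_mul_right (pow_pos (Nat.pos_of_ne_zero hN) 2) hmul

end Brandt

end Literature.NumberTheory.Automorphic
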